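import Mathlib
import Literature.AlgebraicGeometry.Ramification.NormalSylowExtensions
import Literature.AlgebraicGeometry.Resolution.ComponentGluing
import Literature.AlgebraicGeometry.Resolution.RegularLocalRingsNormal
import Summits.ResolutionOfSingularities.ResolutionOfSingularities.Theorems.WildQuotientsWildQuotientResolutionStubInertiaLe
import Summits.ResolutionOfSingularities.ResolutionOfSingularities.Theorems.WildQuotientsWildQuotientResolutionPhaseZeroNormalModel
import HarnessLib

/-!
# `stub_phaseZeroHighDim` reduces to an equivariant regular model of ONE normal model of `X′`
# (crux `WildQuotients.WildQuotientResolution`, line `Sketch`) — the formal repair census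

Crux stmt-ResolutionOfSingularities-15640 (`WildQuotientResolution`), registered stub `stub_phaseZeroHighDim`.
This file states the reduction obtained by this hand as ONE theorem whose conclusion is VERBATIM the
conclusion of the registered stub (for its hypothesis list: `X′` regular integral, `q` finite `G`-invariant,
`ρ` faithful, over `f : X₁ → Spec k` separated of finite type; the stub's `dim X′ ≥ 3` is not needed):

**Theorem** (`phaseZero_conclusion_of_equivariantRegularModels`). Assume
(H1) the typed named fact `AbbesSaito2011_inertiaNormalSylow_after_admissibleBlowup` (Abbes–Saito 2011,
     Prop. 2.22: p-closed inertia after an admissible blow-up and normalisation — a theorem in print);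
(H2) finiteness of relative normalisation over `k` (E. Noether / Nagata — a theorem in print, cf. the tree's
     named fact `Resolution.NoetherFiniteIntegralClosure`);
(H3) **equivariant regular models of the equivariant proper birational integral models of `X′`**: every
     integral `Xs` with a `G`-action and a proper birational `G`-equivariant `Xs → X′` admits a proper
     birational `G`-equivariant `Xr → Xs` with `Xr` integral and REGULAR and a `G`-stable affine cover.
Then the conclusion of `stub_phaseZeroHighDim` holds: a proper birational `G`-equivariant REGULAR integral
model of `X′` all of whose inertia groups are p-closed, with a `G`-stable affine cover.

(H1), (H2) are classical; (H3) — equivariant resolution (principalisation) of the models of the regular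
`X′`, in dimension `≥ 4` and characteristic `p` — is the OPEN residual, and the ONLY one: the stub is
(H3)-hard and, given (H1)(H2), nothing else. Proof: ✓`PhaseZeroNormalModel.exists_normalModel_isProper_forall_hasNormalSylow`
gives the normal model `Xs → X′` with p-closed inertia; (H3) gives `Xr → Xs`; inertia only shrinks along the
equivariant `Xr → Xs` (✓`InertiaLe.stub_inertia_le`, subgroups of p-closed groups are p-closed), properness and
birationality compose (✓`Resolution.IsBirational.comp`).

[OURS · crux stmt-ResolutionOfSingularities-15640 · helper toward `stub_phaseZeroHighDim` (conditional
reduction, NOT a proof of the stub); counted 0; AI-level work, weaker than expert review.]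
-/

-- single-problem summit: the doubled namespace component `ResolutionOfSingularities` is forced
set_option linter.dupNamespace false

noncomputable section

open CategoryTheory CategoryTheory.Limits AlgebraicGeometry TopologicalSpace
open Literature.AlgebraicGeometry.Ramification Literature.AlgebraicGeometry.Resolution

namespace Summit.ResolutionOfSingularities.ResolutionOfSingularities.Theorems.WildQuotientResolution.PhaseZeroReduction

set_option maxHeartbeats 800000 in
/-- **`stub_phaseZeroHighDim`'s conclusion from (H1) Abbes–Saito 2011 Prop. 2.22, (H2) finiteness of
normalisation and (H3) equivariant regular models of the equivariant models of `X′`** — see the module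
docstring. The conclusion is verbatim that of the registered stub. [cite: AbbesSaito2011, Prop. 2.22 (NS4)]
[cite: Liu2002, Prop. 4.1.27] [cite: Matsumura1987, Thm. 19.4] -/
theorem phaseZero_conclusion_of_equivariantRegularModels
    (hAS : AbbesSaito2011_inertiaNormalSylow_after_admissibleBlowup.{0})
    (p : ℕ) (hp : p.Prime) (k : Type) [Field k] [CharP k p]
    (hfin : ∀ (V Q : Scheme.{0}) (g : V ⟶ Q) [QuasiCompact g] [QuasiSeparated g] [IsIntegral V]
      (s : Q ⟶ Spec (.of k)) [LocallyOfFiniteType s] [LocallyOfFiniteType g], IsFinite g.fromNormalization)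
    (X' X₁ : Scheme.{0}) (f : X₁ ⟶ Spec (.of k)) (q : X' ⟶ X₁) (G : Type) [Group G] [Finite G]
    (ρ : G →* Aut X') (hfaith : Function.Injective ρ)
    [IsSeparated f] [LocallyOfFiniteType f] [QuasiCompact f] [IsIntegral X'] (hreg : Scheme.IsRegular X')
    [IsFinite q] (hρ : ∀ g : G, (ρ g).hom ≫ q = q)
    (hres : ∀ (Xs : Scheme.{0}) (πs : Xs ⟶ X') (ρs : G →* Aut Xs), IsIntegral Xs → IsProper πs →
      IsBirational πs → (∀ g : G, (ρs g).hom ≫ πs = πs ≫ (ρ g).hom) →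
      ∃ (Xr : Scheme.{0}) (πr : Xr ⟶ Xs) (ρr : G →* Aut Xr), IsProper πr ∧ IsBirational πr ∧
        IsIntegral Xr ∧ Scheme.IsRegular Xr ∧ (∀ g : G, (ρr g).hom ≫ πr = πr ≫ (ρs g).hom) ∧
        ∀ x : Xr, ∃ U : Xr.Opens, IsAffineOpen U ∧ x ∈ U ∧ ∀ g : G, (ρr g).hom ⁻¹ᵁ U = U) :
    ∃ (Xs : Scheme.{0}) (π : Xs ⟶ X') (ρs : G →* Aut Xs), IsProper π ∧ IsBirational π ∧
      IsIntegral Xs ∧ Scheme.IsRegular Xs ∧ (∀ g : G, (ρs g).hom ≫ π = π ≫ (ρ g).hom) ∧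
      (∀ x : Xs, HasNormalSylow p (inertiaSubgroup ρs x)) ∧
      ∀ x : Xs, ∃ U : Xs.Opens, IsAffineOpen U ∧ x ∈ U ∧ ∀ g : G, (ρs g).hom ⁻¹ᵁ U = U := by
  haveI : Fact p.Prime := ⟨hp⟩
  -- the conditional NORMAL Phase-0 model
  obtain ⟨Xs, πs, ρs, hint, hprop, hbir, hequiv, hNS, -⟩ :=
    PhaseZeroNormalModel.exists_normalModel_isProper_forall_hasNormalSylow hAS p k hfin X' X₁ f q G ρ hfaith
      (fun x => haveI := hreg x; isIntegrallyClosed_of_isRegularLocalRing (X'.presheaf.stalk x)) hρ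
  haveI := hint
  haveI := hprop
  -- its equivariant regular model (H3)
  obtain ⟨Xr, πr, ρr, hpropr, hbirr, hintr, hregr, hequivr, hcovr⟩ := hres Xs πs ρs hint hprop hbir hequiv
  haveI := hpropr
  refine ⟨Xr, πr ≫ πs, ρr, inferInstance, hbirr.comp hbir, hintr, hregr, fun g => ?_, fun x => ?_, hcovr⟩
  · rw [← Category.assoc, hequivr g, Category.assoc, hequiv g, Category.assoc]
  · -- inertia only shrinks along the equivariant `Xr → Xs`
    exact ((hNS (πr.base x)).subgroup ((inertiaSubgroup ρr x).subgroupOf (inertiaSubgroup ρs (πr.base x)))).of_mulEquiv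
      (Subgroup.subgroupOfEquivOfLe (InertiaLe.stub_inertia_le ρr ρs πr hequivr x))

end Summit.ResolutionOfSingularities.ResolutionOfSingularities.Theorems.WildQuotientResolution.PhaseZeroReduction

end
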